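import Mathlib
import Summits.Ventures.HodgeRepro.Tier4.Common.HoloForms
import Summits.Ventures.HodgeRepro.Tier4.Common.HeckeCoeff
import Summits.Ventures.HodgeRepro.Tier4.Common.TargetBridge

/-!
# Tier4/Common/ConcreteWitness — the witness of `Geometry.lean` on the target's own objects (the holomorphic
concrete forms), and (P) for it IS the conclusion of `P_T4`

Blind re-derivation cell `pub-hodge-repro`, Tier 4 (README §9–§10), seat t4-typer-1 (gen 0).  Target tree path
`lean/Summits/Ventures/HodgeRepro/Tier4/Common/ConcreteWitness.lean`.  Imports `HoloForms` (the holomorphic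
concrete `FormAlgebra`), `HeckeCoeff` (the Hecke action on `1`- and `2`-forms of `X_{Γ′}` with its invariance),
`TargetBridge` (the frozen `P_T4` as «∀ datum, conclusion», `d.heckeOf`).

WHAT IS DEFINED.  The identity Hecke element `heckeOne = ⟨[(1, {1})]⟩`; the Hecke elements of level `Γ′`
(`HeckeOf`); the two remaining textbook residuals **(T0)** `IsCornerGoodOn d D` (the corner fields are holomorphic
and bounded measurable on `D` — Osgood regularity of the Albanese lifts) and **(T3)** `IsHeckeGoodOn d Γ' D` (the
Hecke translates of holomorphic concrete forms are holomorphic concrete forms — regularity + compactness),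
bundled with (T1), (T2) of `HoloForms` in `ConcreteResidual d Γ' D`; the Hecke translate `cTranslate` as
a ℂ-linear endomorphism of the concrete forms; and **`concreteWitness`**: the `Witness` of `Geometry.lean` on the
concrete form algebra — `Hecke := HeckeOf Γ'`, `one := heckeOne`, `translate := cTranslate`, `omega :=` the four
corner forms of the datum (`i₁, i₂` with `s`, `i₃, i₄` with `s̄`).

WHAT IS PROVED.  `heckeOne_isFor` (the identity double coset is of every level), `act_one`, `pullField_act_one`,
`pullCoeff_act_one`, `heckeField_one`, `heckeCoeff_one` (the identity acts trivially on forms of `X_{Γ′}`);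
every field of `Witness` (`translate_one`, the Hodge type preserved, `omega_mem`, `omega_ne`);
**`concrete_hodgePairing_eq`**: the abstract Hodge pairing of the concrete witness at the translates `γ` IS the
target's `d.pairing D (heckeOf (γ ∘ val))` (on the ball the corner form of the translated lift is the Hecke
translate of the corner form — `grad_heckeTranslate`, `comp_heckeTranslate` — and `D ⊆ 𝔹²`); hence
**`conclusion_of_concrete_P`**: (P) for the concrete witness gives the conclusion of `P_T4` for `d`, and
**`P_T4_of_concrete`**: `P_T4` follows from (P) for the concrete witness of every datum — the residual of any
line realised this way is EXACTLY `ConcreteResidual` (four displayed textbook facts) plus the choice of the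
fundamental domain `D`.

Nothing here says anything about the status of the Hodge conjecture for CM abelian varieties, which is NOT proved
(HC_CM is NOT proved by anyone in this repository).
-/

set_option autoImplicit false

noncomputable section

open Matrix MeasureTheory NumberField
open scoped ComplexConjugate ComplexOrder

namespace Summit.Ventures.HodgeRepro.Tier4

open Summit.Ventures.HodgeRepro.Tier4.Common

/-- The identity Hecke element: the double coset `Γ′ 1 Γ′` with the single representative `1`. -/
def heckeOne (E : Type) [Field E] : HeckeElement E := ⟨[(1, {1})]⟩

section Groups

variable {E : Type} [Field E] {c : E ≃+* E} {H : Matrix (Fin 3) (Fin 3) E}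

/-- `1` is `H`-unitary. -/
theorem isUnitaryOf_one : IsUnitaryOf c H (1 : Matrix (Fin 3) (Fin 3) E) := by
  unfold IsUnitaryOf cstar
  rw [Matrix.map_one c (map_zero c) (map_one c), Matrix.transpose_one, Matrix.one_mul, Matrix.mul_one]

/-- `{1}` is a complete system of representatives of the double coset `Γ′ 1 Γ′`. -/
theorem isCosetReps_one {Γ : Set (Matrix (Fin 3) (Fin 3) E)} (hΓ : IsCongruenceSubgroup c H Γ) :
    IsCosetReps Γ 1 {1} := by
  refine ⟨fun r hr => ?_, fun γ₁ hγ₁ γ₂ hγ₂ => ?_⟩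
  · rw [Finset.mem_singleton] at hr
    exact ⟨1, hΓ.one_mem, 1, hΓ.one_mem, by rw [hr, Matrix.one_mul, Matrix.one_mul]⟩
  · refine ⟨1, ⟨Finset.mem_singleton_self 1, γ₁ * γ₂, hΓ.mul_mem hγ₁ hγ₂, by rw [Matrix.mul_one, Matrix.mul_one]⟩,
      fun r ⟨hr, _⟩ => Finset.mem_singleton.1 hr⟩

/-- The identity Hecke element is of every level. -/
theorem heckeOne_isFor {Γ : Set (Matrix (Fin 3) (Fin 3) E)} (hΓ : IsCongruenceSubgroup c H Γ) :
    (heckeOne E).IsFor c H Γ := by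
  intro t ht
  simp only [heckeOne, List.mem_singleton] at ht
  subst ht
  exact ⟨1, isUnitaryOf_one, isCosetReps_one hΓ⟩

end Groups

/-- The Jacobian matrix of the identity is the identity. -/
theorem jacMat_id (z : Fin 2 → ℂ) : jacMat (id : (Fin 2 → ℂ) → (Fin 2 → ℂ)) z = 1 := by
  ext j k
  simp only [jacMat, pd, id]
  have : fderiv ℂ (fun w : Fin 2 → ℂ => w j) z = ContinuousLinearMap.proj j :=
    (ContinuousLinearMap.proj j : (Fin 2 → ℂ) →L[ℂ] ℂ).fderiv
  rw [this, ContinuousLinearMap.proj_apply, Matrix.one_apply]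
  by_cases h : j = k
  · subst h; simp
  · simp [h]

/-- The pull-back along the identity is the identity. -/
theorem pullField_id (G : (Fin 2 → ℂ) → (Fin 2 → ℂ)) (z : Fin 2 → ℂ) : pullField id G z = G z := by
  simp [pullField, jacMat_id]

/-- The `2`-form pull-back along the identity is the identity. -/
theorem pullCoeff_id (k : (Fin 2 → ℂ) → ℂ) (z : Fin 2 → ℂ) : pullCoeff id k z = k z := by
  simp [pullCoeff, ← det_jacMat, jacMat_id]

namespace TargetData

variable {F E : Type} [Field F] [NumberField F] [IsGalois ℚ F] [IsCMField F]
  [Field E] [NumberField E] [IsGalois ℚ E] [IsCMField E] (d : TargetData F E)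

/-- The identity matrix acts trivially. -/
theorem act_one : d.act 1 = id := by
  funext z
  simp only [act, toBallMat_one d.τ₀ d.hC.1, actM_one, id]

/-- The Hecke sum of the identity element is the field itself. -/
theorem heckeSum_one (G : (Fin 2 → ℂ) → (Fin 2 → ℂ)) (z : Fin 2 → ℂ) : d.heckeSum (heckeOne E) G z = G z := by
  simp [heckeSum, heckeOne, d.act_one, pullField_id]

/-- The identity Hecke element fixes the `1`-forms supported in the ball. -/
theorem heckeField_one {G : (Fin 2 → ℂ) → (Fin 2 → ℂ)} (hG : ∀ z, z ∉ ball → G z = 0) :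
    d.heckeField (heckeOne E) G = G := by
  funext z
  by_cases hz : z ∈ ball
  · rw [d.heckeField_of_mem _ _ hz, d.heckeSum_one]
  · rw [d.heckeField_of_not_mem _ _ hz, hG z hz]

/-- The Hecke sum of the identity element on a `2`-form is the coefficient itself. -/
theorem heckeCoeffSum_one (k : (Fin 2 → ℂ) → ℂ) (z : Fin 2 → ℂ) : d.heckeCoeffSum (heckeOne E) k z = k z := by
  simp [heckeCoeffSum, heckeOne, d.act_one, pullCoeff_id]

/-- The identity Hecke element fixes the `2`-forms supported in the ball. -/
theorem heckeCoeff_one {k : (Fin 2 → ℂ) → ℂ} (hk : ∀ z, z ∉ ball → k z = 0) :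
    d.heckeCoeff (heckeOne E) k = k := by
  funext z
  by_cases hz : z ∈ ball
  · rw [d.heckeCoeff_of_mem _ _ hz, d.heckeCoeffSum_one]
  · rw [d.heckeCoeff_of_not_mem _ _ hz, hk z hz]

/-- The Hecke elements of level `Γ′`. -/
abbrev HeckeOf (Γ' : Set (Matrix (Fin 3) (Fin 3) E)) : Type := {h : HeckeElement E // h.IsFor (conjE E) d.H Γ'}

/-- **(T0) — the corner fields are holomorphic and bounded measurable on `D`** (the Osgood regularity of the
differentials of the Albanese lifts, and their boundedness on a relatively compact domain; textbook). -/
def IsCornerGoodOn (D : Set (Fin 2 → ℂ)) : Prop :=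
  ∀ (i : Fin 4) (σ : F →+* ℂ) (hσ : σ ∈ d.T i), IsBddMeasOn D (d.cornerField i σ hσ) ∧ IsHolo1 (d.cornerField i σ hσ)

/-- **(T3) — the Hecke translates of holomorphic concrete forms are holomorphic and bounded measurable on `D`**
(regularity and compactness; textbook, see the header). -/
def IsHeckeGoodOn (Γ' : Set (Matrix (Fin 3) (Fin 3) E)) (D : Set (Fin 2 → ℂ)) : Prop :=
  ∀ (h : HeckeElement E), h.IsFor (conjE E) d.H Γ' → ∀ x : FormPair, d.IsHoloForm Γ' D x →
    (IsBddMeasOn D (d.heckeField h x.1) ∧ IsBddMeasOn D (d.heckeCoeff h x.2)) ∧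
      (IsHolo1 (d.heckeField h x.1) ∧ IsHolo2 (d.heckeCoeff h x.2))

/-- **The four textbook residuals of a concrete realisation**, bundled. -/
structure ConcreteResidual (Γ' : Set (Matrix (Fin 3) (Fin 3) E)) (D : Set (Fin 2 → ℂ)) : Prop where
  /-- (T1) positive definiteness of the pairing on the holomorphic concrete forms -/
  pos : d.IsPosDefOnHolo Γ' D
  /-- (T2) finite-dimensionality of the holomorphic concrete forms -/
  fin : FiniteDimensional ℂ (d.HForm Γ' D)
  /-- (T0) the corner fields are holomorphic and bounded measurable on `D` -/
  corner : d.IsCornerGoodOn D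
  /-- (T3) the Hecke translates of holomorphic concrete forms are holomorphic concrete forms -/
  hecke : d.IsHeckeGoodOn Γ' D

/-- A level is a congruence subgroup. -/
theorem IsLevel.congr {Γ' : Set (Matrix (Fin 3) (Fin 3) E)} (h : d.IsLevel Γ') :
    IsCongruenceSubgroup (conjE E) d.H Γ' := h.1

/-- A level is contained in `Γ`. -/
theorem IsLevel.subset {Γ' : Set (Matrix (Fin 3) (Fin 3) E)} (h : d.IsLevel Γ') : Γ' ⊆ d.Γ := h.2

/-- A Hecke element of level `Γ′` carries holomorphic concrete forms to holomorphic concrete forms (given (T3)). -/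
theorem IsHoloForm.hecke {Γ' : Set (Matrix (Fin 3) (Fin 3) E)} {D : Set (Fin 2 → ℂ)}
    (hΓ' : IsCongruenceSubgroup (conjE E) d.H Γ') (hgood : d.IsHeckeGoodOn Γ' D) {h : HeckeElement E}
    (hh : h.IsFor (conjE E) d.H Γ') {x : FormPair} (hx : d.IsHoloForm Γ' D x) :
    d.IsHoloForm Γ' D (d.heckeField h x.1, d.heckeCoeff h x.2) :=
  ⟨⟨d.heckeField_isAutForm1 hΓ' hh hx.1.1, d.heckeCoeff_isAutForm2 hΓ' hh hx.1.2.1, (hgood h hh x hx).1.1,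
    (hgood h hh x hx).1.2⟩, (hgood h hh x hx).2.1, (hgood h hh x hx).2.2⟩

/-- **The concrete Hecke translate** as a ℂ-linear endomorphism of the holomorphic concrete forms. -/
def cTranslate {Γ' : Set (Matrix (Fin 3) (Fin 3) E)} {D : Set (Fin 2 → ℂ)}
    (hΓ' : IsCongruenceSubgroup (conjE E) d.H Γ') (hgood : d.IsHeckeGoodOn Γ' D) (h : d.HeckeOf Γ') :
    d.HForm Γ' D →ₗ[ℂ] d.HForm Γ' D where
  toFun x := ⟨(d.heckeField h.1 x.1.1, d.heckeCoeff h.1 x.1.2), x.2.hecke d hΓ' hgood h.2⟩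
  map_add' x y := Subtype.ext (by
    simp only [Submodule.coe_add, Prod.fst_add, Prod.snd_add, d.heckeField_add, d.heckeCoeff_add]
    rfl)
  map_smul' c x := Subtype.ext (by
    simp only [Submodule.coe_smul, Prod.smul_fst, Prod.smul_snd, d.heckeField_smul, d.heckeCoeff_smul,
      RingHom.id_apply]
    rfl)

/-- The four corner forms of the datum as pairs: corners `i₁, i₂` with `s`, corners `i₃, i₄` with `s̄`. -/
def omegaPair : Fin 4 → FormPair :=
  ![(d.cornerField d.i₁ d.s d.hs₁, 0), (d.cornerField d.i₂ d.s d.hs₂, 0),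
    (d.cornerField d.i₃ (conjEmb d.s) d.hs₃, 0), (d.cornerField d.i₄ (conjEmb d.s) d.hs₄, 0)]

/-- The corner pairs are holomorphic concrete forms (given (T0)). -/
theorem omegaPair_mem {Γ' : Set (Matrix (Fin 3) (Fin 3) E)} {D : Set (Fin 2 → ℂ)} (hΓΓ : Γ' ⊆ d.Γ)
    (hcorner : d.IsCornerGoodOn D) (i : Fin 4) : d.IsHoloForm Γ' D (d.omegaPair i) := by
  fin_cases i <;>
    exact ⟨⟨d.cornerField_isAutForm1 _ _ _ hΓΓ, (d.autForms2 Γ').zero_mem, (hcorner _ _ _).1, IsBddMeasOn.zero⟩,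
      (hcorner _ _ _).2, differentiableOn_const 0⟩

/-- The corner pairs are non-zero. -/
theorem omegaPair_ne_zero (i : Fin 4) : d.omegaPair i ≠ 0 := by
  fin_cases i <;> simp [omegaPair, d.cornerField_ne_zero]

/-- **THE CONCRETE WITNESS**: the `Witness` of `Geometry.lean` on the holomorphic concrete form algebra of `X_{Γ′}`
over `D`, given the level, the domain and the four textbook residuals. -/
def concreteWitness {Γ' : Set (Matrix (Fin 3) (Fin 3) E)} (hΓ' : d.IsLevel Γ') {D : Set (Fin 2 → ℂ)}
    (hD : D ⊆ ball) (hDm : MeasurableSet D) (R : d.ConcreteResidual Γ' D) :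
    Witness (d.holoFormAlgebra Γ' hD hDm R.pos R.fin) where
  Hecke := d.HeckeOf Γ'
  one := ⟨heckeOne E, heckeOne_isFor hΓ'.congr⟩
  translate := d.cTranslate hΓ'.congr R.hecke
  translate_one :=
    LinearMap.ext fun x => Subtype.ext (Prod.ext (d.heckeField_one x.2.1.1.1) (d.heckeCoeff_one x.2.1.2.1.1))
  translate_H10 := fun T α hα => by
    have hα' : α.1.2 = 0 := (d.mem_hH10 Γ' D α).1 hα
    refine (d.mem_hH10 Γ' D _).2 ?_
    show d.heckeCoeff T.1 α.1.2 = 0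
    rw [hα', d.heckeCoeff_zero]
  translate_H20 := fun T α hα => by
    have hα' : α.1.1 = 0 := (d.mem_hH20 Γ' D α).1 hα
    refine (d.mem_hH20 Γ' D _).2 ?_
    show d.heckeField T.1 α.1.1 = 0
    rw [hα', d.heckeField_zero]
  omega := fun i => ⟨d.omegaPair i, d.omegaPair_mem hΓ'.subset R.corner i⟩
  omega_mem := fun i => by
    refine (d.mem_hH10 Γ' D _).2 ?_
    fin_cases i <;> rfl
  omega_ne := fun i h => d.omegaPair_ne_zero i (congrArg Subtype.val h)


/-! ## (P) for the concrete witness is the conclusion of `P_T4` -/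

/-- The Hecke sum only sees the field on the ball (all representatives unitary). -/
theorem heckeSum_congr_ball {G G' : (Fin 2 → ℂ) → (Fin 2 → ℂ)} (hGG : ∀ z ∈ ball, G z = G' z)
    (h : HeckeElement E) (hh : ∀ t ∈ h.terms, ∀ r ∈ t.2, IsUnitaryOf (conjE E) d.H r) {z : Fin 2 → ℂ}
    (hz : z ∈ ball) : d.heckeSum h G z = d.heckeSum h G' z := by
  obtain ⟨ts⟩ := h
  induction ts with
  | nil => simp [heckeSum]
  | cons t ts ih =>
    have hts : ∀ t' ∈ ts, ∀ r ∈ t'.2, IsUnitaryOf (conjE E) d.H r := fun t' ht' => hh t' (List.mem_cons_of_mem _ ht')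
    rw [d.heckeSum_cons, d.heckeSum_cons, ih hts]
    congr 2
    refine Finset.sum_congr rfl fun r hr => ?_
    simp only [pullField]
    rw [hGG _ (d.act_mem_ball_of_unitary (hh t List.mem_cons_self r hr) hz)]

/-- On the ball, the Hecke translate of the corner form is the gradient of the coordinate of the translated lift:
`heckeField h (alb^* ω_{i,σ}) z = grad (coord of T_h a_i) z`. -/
theorem heckeField_cornerField {Γ' : Set (Matrix (Fin 3) (Fin 3) E)} (hΓ' : d.IsLevel Γ') {h : HeckeElement E}
    (hh : h.IsFor (conjE E) d.H Γ') (i : Fin 4) (σ : F →+* ℂ) (hσ : σ ∈ d.T i) {z : Fin 2 → ℂ} (hz : z ∈ ball) :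
    d.heckeField h (d.cornerField i σ hσ) z = grad (heckeTranslate d.τ₀ d.C h (d.coord i σ hσ)) z := by
  have hunit : ∀ t ∈ h.terms, ∀ r ∈ t.2, IsUnitaryOf (conjE E) d.H r := fun t ht r hr =>
    d.isUnitaryOf_of_mem_reps hΓ'.subset hh ht hr
  rw [d.heckeField_of_mem _ _ hz, d.heckeSum_congr_ball (fun w hw => d.cornerField_of_mem i σ hσ hw) h hunit hz,
    d.grad_heckeTranslate (d.differentiableOn_coord i σ hσ) h hunit hz]

/-- The `2`-form coefficient of `f^*Ω_s` for the concrete witness at the translates `γ` agrees ON THE BALL with the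
target's `jac_s` for the Hecke elements `heckeOf (γ ∘ val)`. -/
theorem pullOmegaS_coeff_eq {Γ' : Set (Matrix (Fin 3) (Fin 3) E)} (hΓ' : d.IsLevel Γ') {D : Set (Fin 2 → ℂ)}
    (hD : D ⊆ ball) (hDm : MeasurableSet D) (R : d.ConcreteResidual Γ' D)
    (γ : (d.concreteWitness hΓ' hD hDm R).Translates) {z : Fin 2 → ℂ} (hz : z ∈ ball) :
    ((d.concreteWitness hΓ' hD hDm R).pullOmegaS γ).1.2 z = d.jacS (d.heckeOf fun j => (γ j).1) z := by
  show wedge (d.heckeField (γ 0).1 (d.cornerField d.i₁ d.s d.hs₁) z) (d.heckeField (γ 1).1 (d.cornerField d.i₂ d.s d.hs₂) z) = _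
  unfold TargetData.jacS TargetData.lift
  rw [d.heckeOf_i₁, d.heckeOf_i₂, comp_heckeTranslate, comp_heckeTranslate,
    d.heckeField_cornerField hΓ' (γ 0).2 d.i₁ d.s d.hs₁ hz, d.heckeField_cornerField hΓ' (γ 1).2 d.i₂ d.s d.hs₂ hz]
  rfl

/-- The `2`-form coefficient of `f^*Ω_{s̄}` for the concrete witness agrees on the ball with the target's `jac_{s̄}`. -/
theorem pullOmegaSbar_coeff_eq {Γ' : Set (Matrix (Fin 3) (Fin 3) E)} (hΓ' : d.IsLevel Γ') {D : Set (Fin 2 → ℂ)}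
    (hD : D ⊆ ball) (hDm : MeasurableSet D) (R : d.ConcreteResidual Γ' D)
    (γ : (d.concreteWitness hΓ' hD hDm R).Translates) {z : Fin 2 → ℂ} (hz : z ∈ ball) :
    ((d.concreteWitness hΓ' hD hDm R).pullOmegaSbar γ).1.2 z = d.jacSbar (d.heckeOf fun j => (γ j).1) z := by
  show wedge (d.heckeField (γ 2).1 (d.cornerField d.i₃ (conjEmb d.s) d.hs₃) z)
    (d.heckeField (γ 3).1 (d.cornerField d.i₄ (conjEmb d.s) d.hs₄) z) = _
  unfold TargetData.jacSbar TargetData.lift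
  rw [d.heckeOf_i₃, d.heckeOf_i₄, comp_heckeTranslate, comp_heckeTranslate,
    d.heckeField_cornerField hΓ' (γ 2).2 d.i₃ (conjEmb d.s) d.hs₃ hz,
    d.heckeField_cornerField hΓ' (γ 3).2 d.i₄ (conjEmb d.s) d.hs₄ hz]
  rfl

/-- **The abstract Hodge pairing of the concrete witness IS the target's pairing**:
`W.hodgePairing γ = d.pairing D (heckeOf (γ ∘ val))`. -/
theorem concrete_hodgePairing_eq {Γ' : Set (Matrix (Fin 3) (Fin 3) E)} (hΓ' : d.IsLevel Γ') {D : Set (Fin 2 → ℂ)}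
    (hD : D ⊆ ball) (hDm : MeasurableSet D) (R : d.ConcreteResidual Γ' D)
    (γ : (d.concreteWitness hΓ' hD hDm R).Translates) :
    (d.concreteWitness hΓ' hD hDm R).hodgePairing γ = d.pairing D (d.heckeOf fun j => (γ j).1) := by
  rw [d.pairing_eq_pairing2]
  show pairingC D ((d.concreteWitness hΓ' hD hDm R).pullOmegaS γ).1
    ((d.concreteWitness hΓ' hD hDm R).pullOmegaSbar γ).1 = _
  unfold pairingC
  have h1 : ((d.concreteWitness hΓ' hD hDm R).pullOmegaS γ).1.1 = 0 := rfl
  have h2 : ((d.concreteWitness hΓ' hD hDm R).pullOmegaSbar γ).1.1 = 0 := rfl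
  rw [h1, h2]
  simp only [Pi.zero_apply, zero_mul, Finset.sum_const_zero, integral_zero, zero_add]
  unfold pairing2
  refine setIntegral_congr_fun hDm fun z hz => ?_
  rw [d.pullOmegaS_coeff_eq hΓ' hD hDm R γ (hD hz), d.pullOmegaSbar_coeff_eq hΓ' hD hDm R γ (hD hz)]

/-- The re-indexed Hecke elements of a choice of translates of the concrete witness are of level `Γ′`. -/
theorem isHeckeFor_heckeOf_val {Γ' : Set (Matrix (Fin 3) (Fin 3) E)} (γ : Fin 4 → d.HeckeOf Γ') :
    d.IsHeckeFor Γ' (d.heckeOf fun j => (γ j).1) := by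
  intro i
  obtain ⟨j, hj⟩ := d.heckeOf_mem (fun j => (γ j).1) i
  rw [hj]
  exact (γ j).2

/-- A fundamental domain is a measurable subset of the ball. -/
theorem IsDomain.subset_ball {Γ' : Set (Matrix (Fin 3) (Fin 3) E)} {D : Set (Fin 2 → ℂ)} (hDom : d.IsDomain Γ' D) :
    D ⊆ ball := hDom.2.1

/-- A fundamental domain is measurable. -/
theorem IsDomain.measurableSet {Γ' : Set (Matrix (Fin 3) (Fin 3) E)} {D : Set (Fin 2 → ℂ)}
    (hDom : d.IsDomain Γ' D) : MeasurableSet D := hDom.1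

/-- **(P) FOR THE CONCRETE WITNESS GIVES THE CONCLUSION OF `P_T4`**: for a level `Γ′`, a fundamental domain `D`
and the four textbook residuals, `Witness.P` of the concrete witness is the target's existential conclusion. -/
theorem conclusion_of_concrete_P {Γ' : Set (Matrix (Fin 3) (Fin 3) E)} (hΓ' : d.IsLevel Γ') {D : Set (Fin 2 → ℂ)}
    (hDom : d.IsDomain Γ' D) (R : d.ConcreteResidual Γ' D)
    (hP : (d.concreteWitness hΓ' hDom.subset_ball hDom.measurableSet R).P) : d.conclusion := by
  obtain ⟨γ, hγ⟩ := hP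
  refine d.conclusion_of Γ' hΓ' (d.heckeOf fun j => (γ j).1) (d.isHeckeFor_heckeOf_val γ) D hDom ?_
  rw [← d.concrete_hodgePairing_eq hΓ' hDom.subset_ball hDom.measurableSet R γ]
  exact hγ

end TargetData

/-- **`P_T4` from (P) for the concrete witnesses**: if for every datum some level `Γ′`, some fundamental domain `D`
and the residuals carry (P) for the concrete witness, then `P_T4`. -/
theorem P_T4_of_concrete
    (h : ∀ (F E : Type) [Field F] [NumberField F] [IsGalois ℚ F] [IsCMField F]
      [Field E] [NumberField E] [IsGalois ℚ E] [IsCMField E] (d : TargetData F E),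
      ∃ (Γ' : Set (Matrix (Fin 3) (Fin 3) E)) (hΓ' : d.IsLevel Γ') (D : Set (Fin 2 → ℂ)) (hDom : d.IsDomain Γ' D)
        (R : d.ConcreteResidual Γ' D),
        (d.concreteWitness hΓ' hDom.subset_ball hDom.measurableSet R).P) : P_T4 := by
  refine P_T4_of_forall fun F E _ _ _ _ _ _ _ _ d => ?_
  obtain ⟨Γ', hΓ', D, hDom, R, hP⟩ := h F E d
  exact d.conclusion_of_concrete_P hΓ' hDom R hP

end Summit.Ventures.HodgeRepro.Tier4
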